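import Summits.QuantumFields.BalabanUV.Beta.D1BFx.PackedCoframeWord
import Summits.QuantumFields.BalabanUV.Beta.D1BFx.PackedLettersAtSites

/-!
# `BalabanUV.Beta.D1BFx.PackedNSideDictionary` — road «BF-x» for binder row D1, slot (K), chain step (I) «(A1)-PACKED», brick (D) «N-DICT»
# PART I (FIRST ORDER): **THE (A2-N) DICTIONARY LETTERS `hJN`∕`hJN′` OF PART 3b's END ARE THEOREMS, WITH THE N TABLE AN EXPLICIT, k-FREE
# CHAIN-RULE VERTEX** — for the literal's first-derivative stencil family `S` (structural sockets «no mm block», «fm = kernel-transposed mf»,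
# self-localisation), the road's leg `G₀ := coDressKBmAt (toSite r) (m+1) (KInvStep (m+1) 0)`, the parity-typed jets `kₛ qₛ` PINNED to the blocks of
# `(arr s (vertexOfK G₀ (m+1) S μ y))ˆˢ` (3b's `hkₛ hqₛ`), TB4-W's co-frame jets packed by the `M_T⁻¹`-column responses (3b's `hT₀ hTₛ hA₀ hAₛ hrS`):
# `tj₂ (kₛ + tgram₁ T₀ Tₛ A₀ Aₛ) qₛ = (arr s (vertexOfK G₀ (m+1) (SN m a S) μ y))ˆˢ`, **`SN m a S κ u := twistR (S κ u) + embFF (tBw₁ (m+1) a κ u)`**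
# (the literal's stencil with its multiplier columns RE-SIGNED, plus the twisted co-frame bond kernel of FILE A in the ff block) — the OWNER's ruling
# W-d1p2-g18-4 «`𝒱N k := vertexOfK G₀ (m+1) S_N`, k-CONSTANT» (journal l.40583) as a kernel theorem; with the N-side sockets (u1) = `vertexFamily_vertexOfK`
# on `SN` (`locStencil_SN`) and (u2) = `tendsto_const_nhds`

HONEST DEPENDENCY (cell records, verbatim): «continuum YM on T⁴ ⇐ BetaPertH ∧ nine spine estimates (0/9 proved); BetaPertH ⇐ (D1) ∧ (D4) ∧
CAP+tail; G-an2-4 gates asym, D1 and NE2/3/4.»  HONEST FRAMING (cell contract, verbatim): «discharging `BetaPertH` makes Bałaban's UV stability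
UNCONDITIONAL — a real constructive-QFT result; it is NOT the continuum limit and NOT the Clay problem.»  THIS MODULE DISCHARGES NOTHING of (K),
of D1 or of the wall: [our object] ONE stencil-family DEFINITION (asserting nothing) and [folklore] composition BY NAME of the owner's
`PackedDictionaryLetters.packed_first_kkt`, `PackedBlockGlue.response_siteOf_eq_tsum_colH`, gan24-leaf-05's `PeriodicArrayWrapColH.colH_weight`,
FILE 0 `PackedSortedBridges` (`blocksHat_sortK_twistR`, `arr_twistR`), FILE C `PackedCoframeWord.tgram₁_packed_eq_blocksHat ∕ vertexOfK_embFF`,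
FILE A `TorusWeightWordTwisted.biLoc_tBw₁` and `OneStepKernelFamily.vertexFamily_vertexOfK`.  No `def … : Prop`, nothing cited, 0 sorry.
0∕4 binders of row D1; (K) NOT closed; NOT D1, NOT BetaPertH, NOT continuum, NOT Clay.  SECOND ORDER (`hJN″`, `hWN`, `hlimWN`: `𝒲N k := twistR (𝒲M k) +
embFF (𝒲cof k)`) is PART II, after «COFRAME-PACK-2» (the pair packing of `tgramMix` at packed jets).

ABSOLUTE RULE (cell charter, verbatim): «No internally-minted statement may enter as a cited fact. Every hypothesis is either kernel-proved in this
package or a verbatim quotation of a PUBLISHED theorem with page reference. The manuscript(s) under audit are NOT citable for their own disputed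
steps — they are the thing under adjudication; programme-internal (2001/route/tribunal) claims are never citable.»

CONTENT:
* §1 [folklore] `tj₂_add_eq` (`tj₂ (k + B) q = kkt k q * fromBlocks 1 0 0 (−1) + fromBlocks B 0 0 0`), `arr_add'` (any fibre), `blocksHat_sortK_arr_add`.
* §2 [our object] `SN m a S`; `vertexOfK_twistR`, `vertexOfK_add`, **`vertexOfK_SN`** (`vertexOfK K n (SN m a S) μ y = twistR (vertexOfK K n S μ y) +
  embFF (Σ_κ wsum (colH K n μ y κ) (tBw₁ (m+1) a κ))`), **`locStencil_SN`**, **`vertexFamily_vertexOfK_SN`** ((u1), any decaying `K`).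
* §3 **`tj₂_packed_eq_blocksHat_vertexOfK_SN`** — `hJN`∕`hJN′` per torus at the coarse site `(μ, y)`, in PART 3b's binder types.
Unit `b2b-balaban-beta-d1-formalise-leaf-03` (gen 23); road owner `b2b-balaban-beta-d1-p2` (W-d1p2-g18-4∕-5, journal l.40583).
-/

noncomputable section

namespace Summit.QuantumFields.BalabanUV.Beta.D1BFx.PackedNSideDictionary

open Matrix
open scoped BigOperators
open Literature.Probability.LatticeModels (TorusSite)
open Literature.MathematicalPhysics.QuantumFieldTheory.Balaban1983to89
open Literature.MathematicalPhysics.QuantumFieldTheory.Balaban1983to89.Beta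
open Literature.MathematicalPhysics.QuantumFieldTheory.Balaban1983to89.Beta.Composition (kkt)
open B12Sec2to5 (l1 l1_nonneg)
open ExpKernelCalculus (MKer BiLoc Decays Zl VertexFamily)
open AffineAveraging (box toSite)
open OneStepResolventKernel (Fib wsum LocStencil summable_wsumTerm)
open OneStepKernelFamily (KInvStep colH vertexOfK vertexFamily_vertexOfK)
open KernelWard (biLoc_add)
open Summit.QuantumFields.BalabanUV.Beta.TameKernelCalculus (Spr)
open Summit.QuantumFields.BalabanUV.Beta.AxialDressingRooted (coDressKBmAt decays_coDressKBmAt_KInvStep)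
open Summit.QuantumFields.BalabanUV.Beta.D1BFx.FibredPeriodisation (periodiseF periodiseF_add)
open Summit.QuantumFields.BalabanUV.Beta.D1BFx.SortedKernels (blocksHat blocksHat_eq_reindex fTL fBL)
open Summit.QuantumFields.BalabanUV.Beta.D1BFx.SortedPack (sortK summable_sortK)
open Summit.QuantumFields.BalabanUV.Beta.D1BFx.SortedReblocking (torusBlockEquiv)
open Summit.QuantumFields.BalabanUV.Beta.D1BFx.SortedEmbedding (e₁)
open Summit.QuantumFields.BalabanUV.Beta.D1BFx.PeriodicArrays (arr toF summable_arr_term decays_arr)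
open Summit.QuantumFields.BalabanUV.Beta.D1BFx.GramWeightColourLift (tj₂ tgram₁)
open Summit.QuantumFields.BalabanUV.Beta.D1BFx.TorusCombKKT (I J CombRows tauT Khat Qhat)
open Summit.QuantumFields.BalabanUV.Beta.D1BFx.TorusGaugeBasisMatrix (Nhat)
open Summit.QuantumFields.BalabanUV.Beta.D1BFx.TorusCoframeJets (Tjet₀ Tjet₁ Ajet₀ Ajet₁)
open Summit.QuantumFields.BalabanUV.Beta.D1BFx.TorusBondArrays (dB dB_pos)
open Summit.QuantumFields.BalabanUV.Beta.D1BFx.PeriodicArrayWrapColH (colH_weight)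
open Summit.QuantumFields.BalabanUV.Beta.D1BFx.PackedDictionaryLetters (packed_first_kkt)
open Summit.QuantumFields.BalabanUV.Beta.D1BFx.PackedBlockGlue (response_siteOf_eq_tsum_colH)
open Summit.QuantumFields.BalabanUV.Beta.D1BFx.PackedSortedBridges (embFF twistR twistR_inl twistR_inr biLoc_embFF biLoc_twistR arr_twistR
  blocksHat_sortK_twistR)
open Summit.QuantumFields.BalabanUV.Beta.D1BFx.TorusWeightWordTwisted (tBw₁ biLoc_tBw₁)
open Summit.QuantumFields.BalabanUV.Beta.D1BFx.PackedCoframeWord (biLoc_tBw₁_rate biLoc_cofWord tgram₁_packed_eq_blocksHat vertexOfK_embFF)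

/-! ## §1 Algebra: the twisted bordered jet splits; additivity of the sorted periodised array -/

section Algebra

/-- [folklore] **THE TWISTED BORDERED JET SPLITS**: `tj₂ (k + B) q = kkt k q * fromBlocks 1 0 0 (−1) + fromBlocks B 0 0 0`
(`tj₂ k q = fromBlocks k (−qᵀ) q 0`, `kkt k q = fromBlocks k qᵀ q 0`). -/
theorem tj₂_add_eq {ν' μ' : Type*} [Fintype ν'] [Fintype μ'] [DecidableEq ν'] [DecidableEq μ'] (k B : Matrix ν' ν' ℝ) (q : Matrix μ' ν' ℝ) :
    tj₂ (k + B) q = kkt k q * Matrix.fromBlocks (1 : Matrix ν' ν' ℝ) 0 0 (-1 : Matrix μ' μ' ℝ) + Matrix.fromBlocks B 0 0 0 := by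
  rw [tj₂, kkt, Matrix.fromBlocks_multiply, Matrix.fromBlocks_add]
  simp only [Matrix.mul_one, Matrix.mul_zero, Matrix.mul_neg, add_zero, zero_add, neg_zero]

variable {D : ℕ} {F : Type*}

/-- [folklore] The array is additive on bi-localised kernels (any fibre; TA2's `summable_arr_term`). -/
theorem arr_add' (s : ℕ) [NeZero s] {V W : MKer D F} {pV qV pW qW : Fin D → ℤ} {CV δV CW δW : ℝ} (hV : BiLoc V pV qV CV δV) (hδV : 0 < δV)
    (hW : BiLoc W pW qW CW δW) (hδW : 0 < δW) : arr s (V + W) = arr s V + arr s W := by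
  funext x y a b
  exact (summable_arr_term hV hδV s x y a b).tsum_add (summable_arr_term hW hδW s x y a b)

/-- [folklore] **ADDITIVITY OF THE SORTED PERIODISED ARRAY** for two bi-localised packed kernels:
`blocksHat p (sortK n (arr (n·p) (V + W))) = blocksHat p (sortK n (arr (n·p) V)) + blocksHat p (sortK n (arr (n·p) W))`. -/
theorem blocksHat_sortK_arr_add (n p : ℕ) [NeZero n] [NeZero p] [Fintype F] [DecidableEq F] {V W : MKer D (F ⊕ F)} {pV qV pW qW : Fin D → ℤ}
    {CV δV CW δW : ℝ} (hV : BiLoc V pV qV CV δV) (hδV : 0 < δV) (hW : BiLoc W pW qW CW δW) (hδW : 0 < δW) :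
    blocksHat p (sortK n (arr (n * p) (V + W))) = blocksHat p (sortK n (arr (n * p) V)) + blocksHat p (sortK n (arr (n * p) W)) := by
  have hs : sortK n (arr (n * p) (V + W)) = sortK n (arr (n * p) V) + sortK n (arr (n * p) W) := by
    rw [arr_add' (n * p) hV hδV hW hδW]; rfl
  have hadd : ∀ i j, periodiseF p (sortK n (arr (n * p) (V + W))) i j
      = periodiseF p (sortK n (arr (n * p) V)) i j + periodiseF p (sortK n (arr (n * p) W)) i j := by
    intro i j
    rw [hs]
    exact periodiseF_add (fun a b x => summable_sortK (decays_arr hV hδV (n * p)) (half_pos hδV) a b x)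
      (fun a b x => summable_sortK (decays_arr hW hδW (n * p)) (half_pos hδW) a b x) i j
  rw [blocksHat_eq_reindex, blocksHat_eq_reindex, blocksHat_eq_reindex]
  ext i j
  simp only [Matrix.reindex_apply, Matrix.submatrix_apply, Matrix.add_apply, Matrix.of_apply, hadd]

end Algebra

/-! ## §2 The N-side stencil family `SN` and its chain-rule vertex -/

section Stencil

variable {d : ℕ}

/-- [folklore] `wsum` is additive, entrywise, when both weighted families are summable termwise. -/
theorem wsum_add_apply_of_summable {w : (Fin (d + 1) → ℤ) → ℝ} {A B : (Fin (d + 1) → ℤ) → MKer (d + 1) (Fib d)} (x z : Fin (d + 1) → ℤ)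
    (c b : Fib d) (hA : Summable fun u => w u * A u x z c b) (hB : Summable fun u => w u * B u x z c b) :
    wsum w (fun u => A u + B u) x z c b = wsum w A x z c b + wsum w B x z c b := by
  show (∑' u, w u * (A u + B u) x z c b) = (∑' u, w u * A u x z c b) + ∑' u, w u * B u x z c b
  rw [← hA.tsum_add hB]
  exact tsum_congr fun u => by rw [Pi.add_apply, Pi.add_apply, Pi.add_apply, Pi.add_apply, mul_add]

/-- [folklore] **THE CHAIN-RULE VERTEX IS ADDITIVE IN THE STENCIL FAMILY** (termwise summability of both weighted families). -/
theorem vertexOfK_add_of_summable (K : MKer (d + 1) (Fib d)) (n : ℕ) (A B : Fin (d + 1) → (Fin (d + 1) → ℤ) → MKer (d + 1) (Fib d))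
    (μ : Fin (d + 1)) (y : Fin (d + 1) → ℤ)
    (hA : ∀ κ' x z c b, Summable fun u => colH K n μ y κ' u * A κ' u x z c b)
    (hB : ∀ κ' x z c b, Summable fun u => colH K n μ y κ' u * B κ' u x z c b) :
    vertexOfK K n (fun κ u => A κ u + B κ u) μ y = vertexOfK K n A μ y + vertexOfK K n B μ y := by
  funext x z c b
  simp only [vertexOfK, Pi.add_apply]
  rw [← Finset.sum_add_distrib]
  exact Finset.sum_congr rfl fun κ' _ => wsum_add_apply_of_summable x z c b (hA κ' x z c b) (hB κ' x z c b)

/-- [folklore] `wsum` passes through the right sign-twist, entrywise (no summability needed: `tsum_mul_left`). -/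
theorem wsum_twistR_apply (w : (Fin (d + 1) → ℤ) → ℝ) (A : (Fin (d + 1) → ℤ) → MKer (d + 1) (Fib d)) (x z : Fin (d + 1) → ℤ) (c b : Fib d) :
    wsum w (fun u => twistR (A u)) x z c b = BorderedHessian.sgnF b * wsum w A x z c b := by
  show (∑' u, w u * (BorderedHessian.sgnF b * A u x z c b)) = BorderedHessian.sgnF b * ∑' u, w u * A u x z c b
  rw [← tsum_mul_left]
  exact tsum_congr fun u => by ring

/-- [folklore] **THE CHAIN-RULE VERTEX PASSES THROUGH THE TWIST**: `vertexOfK K n (twistR ∘ S) μ y = twistR (vertexOfK K n S μ y)`. -/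
theorem vertexOfK_twistR (K : MKer (d + 1) (Fib d)) (n : ℕ) (S : Fin (d + 1) → (Fin (d + 1) → ℤ) → MKer (d + 1) (Fib d))
    (μ : Fin (d + 1)) (y : Fin (d + 1) → ℤ) :
    vertexOfK K n (fun κ u => twistR (S κ u)) μ y = twistR (vertexOfK K n S μ y) := by
  funext x z c b
  simp only [vertexOfK, twistR, wsum_twistR_apply, Finset.mul_sum]

variable (m : ℕ) (a : ℝ) (S : Fin 4 → (Fin 4 → ℤ) → MKer 4 (Fib 3))

/-- [our object] **THE N-SIDE FIRST-DERIVATIVE STENCIL FAMILY** `SN m a S κ u := twistR (S κ u) + embFF (tBw₁ (m+1) a κ u)` — the literal's stencil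
with its multiplier COLUMNS re-signed (the twisted bordered jet `tj₂` of the N organisation) plus the twisted first co-frame bond kernel of TB4-W in
the ff block.  A definition; asserts nothing (OWNER ruling W-d1p2-g18-4). -/
def SN : Fin 4 → (Fin 4 → ℤ) → MKer 4 (Fib 3) := fun κ u => twistR (S κ u) + embFF (tBw₁ (m + 1) a κ u)

/-- [our object] Unfolding `SN`. -/
theorem SN_apply (κ : Fin 4) (u : Fin 4 → ℤ) : SN m a S κ u = twistR (S κ u) + embFF (tBw₁ (m + 1) a κ u) := rfl

variable {m a S}

/-- [folklore] **`SN` IS SELF-LOCALISED** with ONE constant: `LocStencil S Cs δ`, `δ ≤ dB (m+1) a ∕ 8` ⟹ `LocStencil (SN m a S) (Cs + Ct) δ`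
(`Ct` = FILE A's `biLoc_tBw₁` constant). -/
theorem locStencil_SN (ha : 0 < a) {Cs δ : ℝ} (hS : LocStencil S Cs δ) (hδB : δ ≤ dB (m + 1) a / 8) :
    ∃ C' : ℝ, 0 ≤ C' ∧ LocStencil (SN m a S) C' δ := by
  obtain ⟨Ct, hCt, ht⟩ := biLoc_tBw₁_rate m ha hδB
  refine ⟨Cs + Ct, add_nonneg ((hS 0 0).nonneg (Sum.inl 0)) hCt, fun κ u => ?_⟩
  rw [SN_apply]
  exact biLoc_add (biLoc_twistR _ (hS κ u)) (biLoc_embFF _ (ht κ u))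

/-- [folklore] **THE CHAIN-RULE VERTEX OF `SN` SPLITS**: for a decaying packed resolvent `K` and a self-localised `S` (rate `≤ dB/8`, `≤` the decay of `K`),
`vertexOfK K (m+1) (SN m a S) μ y = twistR (vertexOfK K (m+1) S μ y) + embFF (Σ_κ wsum (colH K (m+1) μ y κ) (tBw₁ (m+1) a κ))`. -/
theorem vertexOfK_SN (ha : 0 < a) {K : MKer 4 (Fib 3)} {CK δK : ℝ} (hK : Decays K CK δK) (hCK : 0 ≤ CK) {Cs δ : ℝ} (hS : LocStencil S Cs δ)
    (hδ : 0 < δ) (hδB : δ ≤ dB (m + 1) a / 8) (hδK : δ ≤ δK) (μ : Fin 4) (y : Fin 4 → ℤ) :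
    vertexOfK K (m + 1) (SN m a S) μ y
      = twistR (vertexOfK K (m + 1) S μ y) + embFF (fun x z α β => ∑ κ : Fin 4, wsum (colH K (m + 1) μ y κ) (tBw₁ (m + 1) a κ) x z α β) := by
  obtain ⟨Ct, -, ht⟩ := biLoc_tBw₁_rate m ha hδB
  have hw : ∀ κ' u, |colH K (m + 1) μ y κ' u| ≤ CK * Real.exp (-δ * l1 (u - ((m + 1 : ℕ) : ℤ) • y)) := fun κ' => colH_weight hK hCK hδK μ y κ'
  rw [show SN m a S = fun κ u => twistR (S κ u) + embFF (tBw₁ (m + 1) a κ u) from rfl,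
    vertexOfK_add_of_summable K (m + 1) _ _ μ y
      (fun κ' x z c b => summable_wsumTerm (hw κ') (fun u => biLoc_twistR _ (hS κ' u)) hδ hCK x z c b)
      (fun κ' x z c b => summable_wsumTerm (hw κ') (fun u => biLoc_embFF _ (ht κ' u)) hδ hCK x z c b),
    vertexOfK_twistR, vertexOfK_embFF]

/-- [folklore] **(u1) FOR THE N TABLE**: `vertexOfK K (m+1) (SN m a S)` is a vertex family (bi-localised at the coarse bonds' centres, rate `δ∕2`). -/
theorem vertexFamily_vertexOfK_SN (ha : 0 < a) {K : MKer 4 (Fib 3)} {CK δK : ℝ} (hK : Decays K CK δK) (hCK : 0 ≤ CK) {Cs δ : ℝ}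
    (hS : LocStencil S Cs δ) (hδ : 0 < δ) (hδB : δ ≤ dB (m + 1) a / 8) (hδK : δ ≤ δK) :
    ∃ C' : ℝ, 0 ≤ C' ∧ VertexFamily (vertexOfK K (m + 1) (SN m a S)) (m + 1) C' (δ / 2) := by
  obtain ⟨C', hC', hSN⟩ := locStencil_SN (m := m) ha hS hδB
  exact ⟨_, mul_nonneg (Nat.cast_nonneg _) (mul_nonneg (mul_nonneg hCK hC') (ExpKernelCalculus.Zl_pos (half_pos hδ)).le),
    vertexFamily_vertexOfK (N := m + 1) hK hCK hSN hδ hδK⟩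

end Stencil

/-! ## §3 The first-order (A2-N) letter `hJN` per torus -/

section Letter

variable (m : ℕ) {a : ℝ} (p : ℕ) [NeZero p] {r : Fin 4 → ℕ}

/-- [folklore] **(D) «N-DICT» PART I — `hJN`∕`hJN′` OF PART 3b AS A THEOREM.**  For `0 < a`, `r ∈ box 4 (m+1)`, the literal's first-derivative stencil
family `S` with «no mm block», «fm = kernel-transposed mf» and self-localisation (`LocStencil S Cs δS`); on the torus of period `p` and at the coarse bond
`(μ, y)`: the parity-typed jets `kₛ qₛ` PINNED to the blocks of `(arr s (vertexOfK G₀ (m+1) S μ y))ˆˢ`, the responses `rS` PINNED to the `M_T⁻¹`-column at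
`(siteOf p y, μ)`, TB4-W's co-frame jets pinned and packed by `rS` (PART 3b's `hkₛ hqₛ hrS hT₀ hTₛ hA₀ hAₛ`, `k`-th instances) — THEN
`tj₂ (kₛ + tgram₁ T₀ Tₛ A₀ Aₛ) qₛ = blocksHat p (sortK (m+1) (arr s (vertexOfK G₀ (m+1) (SN m a S) μ y)))` — PART 3b's `hJN` (`y := 0`) ∕ `hJN′`
(`μ := ν`, `y := z`) with `𝒱N k := vertexOfK G₀ (m+1) (SN m a S)` for every `k`. -/
theorem tj₂_packed_eq_blocksHat_vertexOfK_SN (ha : 0 < a) (hr : r ∈ box (3 + 1) (m + 1))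
    (S : Fin 4 → (Fin 4 → ℤ) → MKer 4 (Fib 3)) {Cs δS : ℝ} (hS : LocStencil S Cs δS) (hδS : 0 < δS)
    (hSmm : ∀ κ' u x y (c b : Fin 4), S κ' u x y (Sum.inr c) (Sum.inr b) = 0)
    (hSfm : ∀ κ' u x y (c b : Fin 4), S κ' u x y (Sum.inl c) (Sum.inr b) = S κ' u y x (Sum.inr b) (Sum.inl c))
    (μ : Fin 4) (y : Fin 4 → ℤ)
    (rS : I 3 (m + 1) p → ℝ)
    (hrS : ∀ i, rS i = (kkt (Khat (d := 3) (m + 1) p) (Matrix.fromRows (Qhat (d := 3) (m + 1) p) (tauT (toSite r) (m + 1) p)))⁻¹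
      (Sum.inl i) (Sum.inr (Sum.inl (siteOf 4 p y, μ))))
    (T₀ Tₛ : Matrix (CombRows (toSite r) (m + 1) p) (I 3 (m + 1) p) ℝ) (A₀ Aₛ : Matrix (CombRows (toSite r) (m + 1) p) (CombRows (toSite r) (m + 1) p) ℝ)
    (hT₀ : T₀ = Tjet₀ ((m + 1) * p) (Nhat r (m + 1) p) (e₁ (m + 1) p))
    (hTₛ : Tₛ = ∑ i : I 3 (m + 1) p, rS i • Tjet₁ ((m + 1) * p) (e₁ (m + 1) p i) (Nhat r (m + 1) p) (e₁ (m + 1) p))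
    (hA₀ : A₀ = Ajet₀ ((m + 1) * p) (Nhat r (m + 1) p))
    (hAₛ : Aₛ = ∑ i : I 3 (m + 1) p, rS i • Ajet₁ ((m + 1) * p) (e₁ (m + 1) p i) (Nhat r (m + 1) p))
    (kₛ : Matrix (I 3 (m + 1) p) (I 3 (m + 1) p) ℝ) (qₛ : Matrix (J 3 p) (I 3 (m + 1) p) ℝ)
    (hkₛ : kₛ = Matrix.of (periodiseF p (fTL (sortK (m + 1) (arr ((m + 1) * p)
      (vertexOfK (coDressKBmAt (toSite r) (m + 1) (KInvStep (d := 3) (m + 1) 0)) (m + 1) S μ y))))))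
    (hqₛ : qₛ = Matrix.of (periodiseF p (fBL (sortK (m + 1) (arr ((m + 1) * p)
      (vertexOfK (coDressKBmAt (toSite r) (m + 1) (KInvStep (d := 3) (m + 1) 0)) (m + 1) S μ y)))))) :
    tj₂ (kₛ + tgram₁ T₀ Tₛ A₀ Aₛ) qₛ
      = blocksHat p (sortK (m + 1) (arr ((m + 1) * p)
          (vertexOfK (coDressKBmAt (toSite r) (m + 1) (KInvStep (d := 3) (m + 1) 0)) (m + 1) (SN m a S) μ y))) := by
  -- the road's resolvent, a common rate below `δS`, `δG` and FILE A's `dB/8`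
  obtain ⟨δG, CG, hδG, hCG, hG⟩ := decays_coDressKBmAt_KInvStep (d := 3) hr 0
  have hd := dB_pos (m + 1) a ha
  set δ₀ : ℝ := min (min δS δG) (dB (m + 1) a / 8) with hδ₀
  have hδ₀pos : 0 < δ₀ := lt_min (lt_min hδS hδG) (by linarith)
  have hδ₀S : δ₀ ≤ δS := (min_le_left _ _).trans (min_le_left _ _)
  have hδ₀G : δ₀ ≤ δG := (min_le_left _ _).trans (min_le_right _ _)
  have hδ₀B : δ₀ ≤ dB (m + 1) a / 8 := min_le_right _ _
  have hS₀ : LocStencil S Cs δ₀ := fun κ u => StepJetData.biLoc_weaken (hS κ u) le_rfl hδ₀S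
  have hCs : 0 ≤ Cs := (hS 0 0).nonneg (Sum.inl 0)
  -- the packing weights `colH G₀ (m+1) μ y` and the response letter (PART 1c)
  have hw : ∀ κ' u, |colH (coDressKBmAt (toSite r) (m + 1) (KInvStep (d := 3) (m + 1) 0)) (m + 1) μ y κ' u|
      ≤ CG * Real.exp (-δ₀ * l1 (u - ((m + 1 : ℕ) : ℤ) • y)) := fun κ' => colH_weight hG hCG hδ₀G μ y κ'
  have hrS' : ∀ i, rS i = ∑' t : Fin 4 → ℤ, colH (coDressKBmAt (toSite r) (m + 1) (KInvStep (d := 3) (m + 1) 0)) (m + 1) μ y i.2.2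
      (imageShift ((m + 1) * p) (windowMap 4 ((m + 1) * p) (torusBlockEquiv (m + 1) p (i.1, i.2.1))) t) := fun i => by
    rw [hrS i]; exact response_siteOf_eq_tsum_colH hr p y μ i
  -- the two bi-localised summands of `vertexOfK G₀ (SN)`
  have hV : BiLoc (vertexOfK (coDressKBmAt (toSite r) (m + 1) (KInvStep (d := 3) (m + 1) 0)) (m + 1) S μ y)
      ((((m + 1 : ℕ) : ℤ)) • y) ((((m + 1 : ℕ) : ℤ)) • y) (((3 + 1 : ℕ) : ℝ) * (CG * Cs * Zl (3 + 1) (δ₀ / 2))) (δ₀ / 2) :=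
    vertexFamily_vertexOfK (N := m + 1) hG hCG hS₀ hδ₀pos hδ₀G μ y
  obtain ⟨C', -, hW⟩ := biLoc_cofWord m ha hw hδ₀pos hδ₀B
  -- assemble
  rw [tj₂_add_eq, hkₛ, hqₛ, ← packed_first_kkt p _ μ y hSmm hSfm, ← blocksHat_sortK_twistR, ← arr_twistR, hT₀, hTₛ, hA₀, hAₛ,
    tgram₁_packed_eq_blocksHat m p ha hr hw hδ₀pos hδ₀B hrS',
    ← blocksHat_sortK_arr_add (m + 1) p (biLoc_twistR _ hV) (half_pos hδ₀pos) hW (half_pos hδ₀pos),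
    vertexOfK_SN (m := m) ha hG hCG hS₀ hδ₀pos hδ₀B hδ₀G μ y]

end Letter

end Summit.QuantumFields.BalabanUV.Beta.D1BFx.PackedNSideDictionary

end
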